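import Literature.NumberTheory.LFunctions.VinogradovKorobovDirichlet
import HarnessLib

/-!
# Khale's explicit Vinogradov–Korobov region for `L(s, χ)` (Theorem 1.1): the reductions of its printed proof

Topic `Literature/NumberTheory/LFunctions`.  Sibling PROOF file of `VinogradovKorobovDirichlet.lean` for the
named fact `Literature.NumberTheory.LFunctions.Khale2024_zeroFreeRegion` (T. Khale, *An explicit
Vinogradov–Korobov zero-free region for Dirichlet L-functions*, Q. J. Math. 75 (2024) 299–332 =
arXiv:2210.06457v1, **Theorem 1.1, (1.2)**: for `q ≥ 3` and every `χ` mod `q`, `L(σ + it, χ) ≠ 0` for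
`|t| ≥ 10`, `σ ≥ 1 − 1/(10.5 log q + 61.5 (log|t|)^{2/3}(log log|t|)^{1/3})`).
**Everything in this file is PROVED; no named fact is introduced** (the two `def`s are parametrised
hypothesis predicates, in the manner of `HasVKZeroFreeRegion c T₀` of the parent file and
`HasClassicalZeroFreeRegion R` of `ExplicitZeroFreeRegionInputs.lean`).

## Status of the discharge (2026-08-15): not discharged — XL

The printed proof of Theorem 1.1 (pp. 3–6 of the source) has three inputs, none of which is in the
tree for `L(s, χ)`:

* **(2.3)** McCurley's explicit classical region [Math. Comp. 42 (1984), Theorem 1.1; proof in J. Number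
  Theory 19 (1984)]: with `R = 9.645908801`, `∏_{χ mod q} L(s, χ)` has at most one zero in
  `σ ≥ 1 − 1/(R log max{q, q|t|, 10})`, and that zero, if present, is real (and simple) — used for
  `10 ≤ t ≤ e^{1944}`;
* **(2.4)** Ford's Richert-type bound for the HURWITZ zeta function,
  `|ζ(σ + it, u) − u^{−s}| ≤ A t^{B(1−σ)^{3/2}}(log t)^{2/3}` with `(A, B) = (76.2, 4.45)` [Ford, Proc.
  LMS 85 (2002), Theorem 1] (the tree's named fact `zeta_bound_ford` is the `ζ` case only);
* **Theorem 3.1** (the bootstrapping zero-detector, §§4–10 and Appendix A of the source: one-sided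
  explicit `N(T, χ)`, Jensen-type lemmas in a strip, the degree-4 trigonometric inequality (7.1), the
  functions `f, F, K` of §8, all numerics "carried out using Mathematica 12"), applied at
  `A = 76.2`, `B = 4.45`, `T₀ = e^{1944}` and combined with the numerical bounds (3.4)–(3.5) to give the
  slightly stronger region **(3.3)**
  `σ ≥ 1 − 1/(10.3 log q + 9.791 log log q + 61.306 (log t)^{2/3}(log log t)^{1/3})` for `t ≥ e^{1944}`.

(Appendix B of the source — the INEXPLICIT region (1.4), needed in §10 to start the extremal-zero
argument — is a theorem of the tree: `VKZeta.exists_hasVKZeroFreeRegion`, `VinogradovZetaSumEstimate.lean`.)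

## What this file proves: "Proof of Theorem 1.1, assuming Theorem 3.1" (pp. 3, 5–6 of the source)

* `HasMcCurleyZeroFreeRegion R` — the off-axis content of (2.3) as a predicate in the constant `R`
  (monotone: `HasMcCurleyZeroFreeRegion.mono`), and `HasKhaleRegionFrom T₀ a b c` — a region of the
  shape (3.1)/(3.3), `σ ≥ 1 − 1/(a log q + b log log q + c (log t)^{2/3}(log log t)^{1/3})` for `t ≥ T₀`,
  `q ≥ 3` (monotone in `(a, b, c)`: `HasKhaleRegionFrom.mono`);
* `conj_LFunction_conj_of_ne_one` — the reflection principle `conj L(conj s, χ) = L(s, χ̄)` for EVERY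
  Dirichlet character (principal ones included) and `s ≠ 1`, and from it
  `Khale2024_zeroFreeRegion_of_upperHalfPlane`: it suffices to treat `t ≥ 10` (p. 3 of the source:
  "the zeros of `L(s, χ)L(s, χ̄)` come in conjugate pairs … we will impose the restriction `Im(s) ≥ 0`
  without loss of generality");
* `KhaleVK.khale_region_of_mccurley_smallHeight` — **(2.3) ⟹ (1.2) for `10 ≤ t ≤ e^{1944}`** ("Theorem 1.1
  is a consequence of (2.3) when `t ≤ e^{1944}`", p. 5): here `max{q, qt, 10} = qt`, and
  `9.645908801 (log q + log t) ≤ 10.5 log q + 61.5 (log t)^{2/3}(log log t)^{1/3}` because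
  `9.645908801³ log t ≤ 61.5³ log log t` on `log 10 ≤ log t ≤ 1944` (`log u/u` is decreasing on `[e, ∞)`
  and `log 1944 ≥ 7.55`; the crossover `(61.5/9.6459…)³ = log t/log log t` is at `log t ≈ 1965`);
* `KhaleVK.khale_region_of_region33_largeHeight` — **(3.3) for `t ≥ e^{1944}` ⟹ (1.2) there** (p. 5: the
  source splits at `q = e^{428}`; we use both slacks at once:
  `9.791 log log q ≤ 0.2 log q + 0.194 (log t)^{2/3}(log log t)^{1/3}`, from `log L ≤ L/49 + 3` and
  `(log t)^{2/3}(log log t)^{1/3} ≥ 155 · 1.9` for `log t ≥ 1944`);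
* `Khale2024_zeroFreeRegion_of_mccurley_of_region33` — **Theorem 1.1 from (2.3) and (3.3)-above-`e^{1944}`**,
  i.e. from McCurley's theorem and the output of Theorem 3.1 at `(A, B, T₀) = (76.2, 4.45, e^{1944})`
  after (3.4)–(3.5).

So the named fact is reduced to exactly the two analytic inputs of its printed proof; what remains
for `Khale2024_zeroFreeRegion_holds` is McCurley's Theorem 1.1 and Khale's Theorem 3.1 fed with Ford's
Hurwitz bound — each a theory of its own.

## References

* T. Khale, *An explicit Vinogradov–Korobov zero-free region for Dirichlet L-functions*, Q. J. Math. 75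
  (2024), no. 1, 299–332; arXiv:2210.06457v1 (numbering used here): Theorem 1.1, (2.3), (2.4),
  Theorem 3.1, (3.3)–(3.5), "Proof of Theorem 1.1, assuming Theorem 3.1" (pp. 5–6). [Khale2024]
* K. S. McCurley, *Explicit estimates for the error term in the prime number theorem for arithmetic
  progressions*, Math. Comp. 42 (1984), no. 165, 265–285, Theorem 1.1 (p. 266). [McCurley1984ErrorTermAP]
* K. Ford, *Vinogradov's integral and bounds for the Riemann zeta function*, Proc. London Math. Soc.
  (3) 85 (2002), 565–633, Theorem 1. [Ford2002]
-/

noncomputable section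

open Complex Filter Topology Set
open scoped ComplexConjugate

namespace Literature.NumberTheory.LFunctions

/-! ## The two inputs of the printed proof, as predicates -/

/-- **McCurley's explicit classical zero-free region, off the real axis**, as a predicate in the
constant `R`: for every modulus `q ≥ 1`, every Dirichlet character `χ` mod `q` and every
`s = σ + it` with `t ≠ 0`, `σ ≥ 1 − 1/(R log max{q, q|t|, 10}) ⟹ L(s, χ) ≠ 0`.
McCurley's Theorem 1.1 (Math. Comp. 42 (1984), p. 266, with `R = 9.645908801`; proof in J. Number
Theory 19 (1984)) says more: `∏_{χ mod q} L(s, χ)` has at most a single zero in that region, and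
"the only possible zero in this region is a simple real zero arising from an `L`-function formed
with a real nonprincipal character"; Khale's (2.3) quotes it as "`L(σ + it, χ)` is non-vanishing
for `t ≥ 0` and `σ ≥ 1 − 1/(9.64590880 log max{q, qt, 10})` apart from a possible real zero which is
necessarily simple".  Only the off-axis part is used (at `|t| ≥ 10`).
[cite: McCurley1984ErrorTermAP, Theorem 1.1] [cite: Khale2024, (2.3)] -/
def HasMcCurleyZeroFreeRegion (R : ℝ) : Prop :=
  ∀ (q : ℕ) [NeZero q] (χ : DirichletCharacter ℂ q) (s : ℂ), s.im ≠ 0 →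
    1 - 1 / (R * Real.log (max (q : ℝ) (max ((q : ℝ) * |s.im|) 10))) ≤ s.re → χ.LFunction s ≠ 0

/-- **A zero-free region of the shape (3.1)/(3.3) of the source from height `T₀`**, as a predicate in
`(T₀, a, b, c)`: for every `q ≥ 3`, every `χ` mod `q` and every `s = σ + it` with `t ≥ T₀`,
`σ ≥ 1 − 1/(a log q + b log log q + c (log t)^{2/3}(log log t)^{1/3}) ⟹ L(s, χ) ≠ 0` (upper
half-plane only, as throughout the source, p. 3).  Theorem 3.1 of the source concludes
`HasKhaleRegionFrom T₀ (10.082 + 1.607/log log T₀) 9.791 (B^{2/3} M₁⁻¹)`; at `(A, B, T₀) =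
(76.2, 4.45, e^{1944})` the bounds (3.4)–(3.5) make this `HasKhaleRegionFrom (exp 1944) 10.3 9.791 61.306`,
i.e. (3.3) above `e^{1944}`. [cite: Khale2024, Theorem 3.1 and (3.3)] -/
def HasKhaleRegionFrom (T₀ a b c : ℝ) : Prop :=
  ∀ (q : ℕ) [NeZero q], 3 ≤ q → ∀ (χ : DirichletCharacter ℂ q) (s : ℂ), T₀ ≤ s.im →
    1 - 1 / (a * Real.log q + b * Real.log (Real.log q) +
        c * Real.log s.im ^ (2 / 3 : ℝ) * Real.log (Real.log s.im) ^ (1 / 3 : ℝ)) ≤ s.re →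
      χ.LFunction s ≠ 0

namespace KhaleVK

/-! ### Numerical constants -/

/-- `e² ≤ 10`, hence `2 ≤ log 10`. [folklore] -/
theorem two_le_log_ten : 2 ≤ Real.log 10 := by
  rw [Real.le_log_iff_exp_le (by norm_num)]
  have h : Real.exp 2 = Real.exp 1 ^ 2 := by exact_mod_cast (Real.exp_one_pow 2).symm
  calc Real.exp 2 = Real.exp 1 ^ 2 := h
    _ ≤ 2.7182818286 ^ 2 := by gcongr; exact Real.exp_one_lt_d9.le
    _ ≤ 10 := by norm_num

/-- `log 49 ≤ 4` (`49 ≤ 2.7182818283⁴`). [folklore] -/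
theorem log_49_le : Real.log 49 ≤ 4 := by
  rw [Real.log_le_iff_le_exp (by norm_num)]
  have h : Real.exp 4 = Real.exp 1 ^ 4 := by exact_mod_cast (Real.exp_one_pow 4).symm
  calc (49 : ℝ) ≤ 2.7182818283 ^ 4 := by norm_num
    _ ≤ Real.exp 1 ^ 4 := by gcongr; exact Real.exp_one_gt_d9.le
    _ = Real.exp 4 := h.symm

/-- `e^{151} ≤ 1944^{20}`, i.e. `e^{7.55} ≤ 1944`. [folklore] -/
theorem exp_le_1944 : Real.exp (151 / 20) ≤ 1944 := by
  have h1 : Real.exp 151 ≤ (1944 : ℝ) ^ 20 := by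
    have h : Real.exp 151 = Real.exp 1 ^ 151 := by exact_mod_cast (Real.exp_one_pow 151).symm
    calc Real.exp 151 = Real.exp 1 ^ 151 := h
      _ ≤ 2.7182818286 ^ 151 := by gcongr; exact Real.exp_one_lt_d9.le
      _ ≤ 1944 ^ 20 := by norm_num
  have h2 : Real.exp (151 / 20) ^ 20 = Real.exp 151 := by
    rw [← Real.exp_nat_mul]; norm_num
  by_contra hlt
  rw [not_le] at hlt
  have h3 : (1944 : ℝ) ^ 20 < Real.exp (151 / 20) ^ 20 := by gcongr
  rw [h2] at h3
  linarith

/-- `7.55 ≤ log 1944` (the true value is `7.5725…`; the crossover of (1.2) and (2.3) needs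
`log 1944 ≥ 7.5008`). [folklore] -/
theorem log_1944_ge : (151 / 20 : ℝ) ≤ Real.log 1944 := by
  rw [Real.le_log_iff_exp_le (by norm_num)]
  exact exp_le_1944

/-- `x = x^{2/3} · x^{1/3}` for `x > 0`. [folklore] -/
theorem rpow_two_thirds_mul_third {x : ℝ} (hx : 0 < x) : x ^ (2 / 3 : ℝ) * x ^ (1 / 3 : ℝ) = x := by
  rw [← Real.rpow_add hx]; norm_num

/-! ### The crossover inequality below `e^{1944}` -/

/-- **The key numerical inequality of the small-height range**: for `log 10 ≤ u ≤ 1944`,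
`897.5 u ≤ 232608.375 log u` (`897.5 > 9.645908801³`, `232608.375 = 61.5³`).  On `[e, 1944]`,
`log u/u ≥ log 1944/1944 ≥ 7.55/1944` (antitonicity of `log u/u`); on `[log 10, e)`, `log u ≥ log 2`
and `u < 3`. [cite: Khale2024, Proof of Theorem 1.1 (p. 5)] -/
theorem crossover_ineq {u : ℝ} (hu : Real.log 10 ≤ u) (hu' : u ≤ 1944) :
    897.5 * u ≤ 232608.375 * Real.log u := by
  have h10 := two_le_log_ten
  have hu0 : 0 < u := by linarith
  rcases le_or_gt (Real.exp 1) u with he | he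
  · have h1944 : (1944 : ℝ) ∈ Set.Ici (Real.exp 1) :=
      Set.mem_Ici.2 (Real.exp_one_lt_d9.le.trans (by norm_num))
    have hanti := Real.log_div_self_antitoneOn (Set.mem_Ici.2 he) h1944 hu'
    -- `hanti : log 1944 / 1944 ≤ log u / u`
    have h1 : (151 / 20 : ℝ) / 1944 ≤ Real.log u / u :=
      le_trans (div_le_div_of_nonneg_right log_1944_ge (by norm_num)) hanti
    rw [le_div_iff₀ hu0] at h1
    linarith
  · -- `u < e < 3` and `log u ≥ log 2`
    have hu3 : u < 3 := he.trans (Real.exp_one_lt_d9.trans (by norm_num))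
    have h2u : (2 : ℝ) ≤ u := h10.trans hu
    have hlog : Real.log 2 ≤ Real.log u := Real.log_le_log (by norm_num) h2u
    have hlog2 := Real.log_two_gt_d9
    nlinarith

/-- **The cube-root form**: for `log 10 ≤ u ≤ 1944`,
`9.645908801 · u^{1/3} ≤ 61.5 (log u)^{1/3}`. [cite: Khale2024, Proof of Theorem 1.1 (p. 5)] -/
theorem crossover_rpow {u : ℝ} (hu : Real.log 10 ≤ u) (hu' : u ≤ 1944) :
    9.645908801 * u ^ (1 / 3 : ℝ) ≤ 61.5 * Real.log u ^ (1 / 3 : ℝ) := by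
  have h10 := two_le_log_ten
  have hu0 : 0 < u := by linarith
  have hv0 : 0 < Real.log u := Real.log_pos (by linarith)
  have ha : 0 ≤ 9.645908801 * u ^ (1 / 3 : ℝ) := by positivity
  have hb : 0 ≤ 61.5 * Real.log u ^ (1 / 3 : ℝ) := by positivity
  rw [← pow_le_pow_iff_left₀ ha hb (by norm_num : (3 : ℕ) ≠ 0)]
  have hkey := crossover_ineq hu hu'
  -- cube of a cube root (the tree's `VK.rpow_one_third_pow_three`, not imported here)
  have hcube : ∀ {x : ℝ}, 0 ≤ x → (x ^ (1 / 3 : ℝ)) ^ 3 = x := fun hx ↦ by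
    rw [← Real.rpow_mul_natCast hx]; norm_num
  calc (9.645908801 * u ^ (1 / 3 : ℝ)) ^ 3 = 9.645908801 ^ 3 * u := by
        rw [mul_pow, hcube hu0.le]
    _ ≤ 897.5 * u := by
        have : (9.645908801 : ℝ) ^ 3 ≤ 897.5 := by norm_num
        nlinarith
    _ ≤ 232608.375 * Real.log u := hkey
    _ = (61.5 * Real.log u ^ (1 / 3 : ℝ)) ^ 3 := by
        rw [mul_pow, hcube hv0.le]; norm_num

/-- **(1.2) is contained in (2.3) for `10 ≤ t ≤ e^{1944}`**: for `q ≥ 3` and `log 10 ≤ log t ≤ 1944`,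
`9.645908801 (log q + log t) ≤ 10.5 log q + 61.5 (log t)^{2/3}(log log t)^{1/3}`.
[cite: Khale2024, Proof of Theorem 1.1 (p. 5)] -/
theorem mccurley_den_le_khale_den {L u : ℝ} (hL : 0 ≤ L) (hu : Real.log 10 ≤ u) (hu' : u ≤ 1944) :
    9.645908801 * (L + u) ≤
      10.5 * L + 61.5 * u ^ (2 / 3 : ℝ) * Real.log u ^ (1 / 3 : ℝ) := by
  have h10 := two_le_log_ten
  have hu0 : 0 < u := by linarith
  have h23 : 0 ≤ u ^ (2 / 3 : ℝ) := by positivity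
  have hcube := crossover_rpow hu hu'
  have hmain : 9.645908801 * u ≤ 61.5 * u ^ (2 / 3 : ℝ) * Real.log u ^ (1 / 3 : ℝ) :=
    calc 9.645908801 * u = u ^ (2 / 3 : ℝ) * (9.645908801 * u ^ (1 / 3 : ℝ)) := by
          conv_lhs => rw [← rpow_two_thirds_mul_third hu0]
          ring
      _ ≤ u ^ (2 / 3 : ℝ) * (61.5 * Real.log u ^ (1 / 3 : ℝ)) :=
          mul_le_mul_of_nonneg_left hcube h23
      _ = 61.5 * u ^ (2 / 3 : ℝ) * Real.log u ^ (1 / 3 : ℝ) := by ring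
  nlinarith

/-! ### The small-height range: McCurley's region -/

/-- **Theorem 1.1 for `10 ≤ t ≤ e^{1944}` from McCurley's region (2.3)** ("Theorem 1.1 is a consequence
of (2.3) when `t ≤ e^{1944}`", p. 5 of the source): for `q ≥ 3`, `10 ≤ t ≤ e^{1944}`,
`max{q, qt, 10} = qt` and the denominator `9.645908801 log(qt)` of (2.3) is at most Khale's
`10.5 log q + 61.5 (log t)^{2/3}(log log t)^{1/3}` (`mccurley_den_le_khale_den`), so the region (1.2)
lies inside McCurley's, off the real axis.
[cite: Khale2024, Proof of Theorem 1.1 (p. 5)] [cite: McCurley1984ErrorTermAP, Theorem 1.1] -/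
theorem khale_region_of_mccurley_smallHeight (hR : HasMcCurleyZeroFreeRegion 9.645908801)
    {q : ℕ} [NeZero q] (hq : 3 ≤ q) (χ : DirichletCharacter ℂ q) {s : ℂ} (ht : 10 ≤ s.im)
    (ht' : s.im ≤ Real.exp 1944)
    (hσ : 1 - 1 / (10.5 * Real.log q +
        61.5 * Real.log |s.im| ^ (2 / 3 : ℝ) * Real.log (Real.log |s.im|) ^ (1 / 3 : ℝ)) ≤ s.re) :
    χ.LFunction s ≠ 0 := by
  have ht0 : 0 < s.im := by linarith
  have habs : |s.im| = s.im := abs_of_pos ht0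
  have hq3 : (3 : ℝ) ≤ q := by exact_mod_cast hq
  have hq0 : (0 : ℝ) < q := by linarith
  refine hR q χ s ht0.ne' (le_trans ?_ hσ)
  have hM : max (q : ℝ) (max ((q : ℝ) * |s.im|) 10) = q * s.im := by
    rw [habs]
    have h1 : (q : ℝ) ≤ q * s.im := by nlinarith
    have h2 : (10 : ℝ) ≤ q * s.im := by nlinarith
    rw [max_eq_left h2, max_eq_right h1]
  rw [hM, habs]
  have hu : Real.log 10 ≤ Real.log s.im := Real.log_le_log (by norm_num) ht
  have hu' : Real.log s.im ≤ 1944 := by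
    have := Real.log_le_log ht0 ht'
    rwa [Real.log_exp] at this
  have hlogq : 0 ≤ Real.log q := Real.log_natCast_nonneg q
  have hqt : Real.log ((q : ℝ) * s.im) = Real.log q + Real.log s.im :=
    Real.log_mul hq0.ne' ht0.ne'
  have hden := mccurley_den_le_khale_den hlogq hu hu'
  have hpos : 0 < 9.645908801 * Real.log ((q : ℝ) * s.im) := by
    rw [hqt]
    have : 0 < Real.log s.im := by linarith [two_le_log_ten]
    positivity
  rw [hqt] at hpos ⊢
  have := one_div_le_one_div_of_le hpos hden
  linarith

/-! ### The large-height range: the output (3.3) of Theorem 3.1 -/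

/-- Lower bound for Khale's `(log t)^{2/3}(log log t)^{1/3}` above `e^{1944}`: for `u ≥ 1944`,
`u^{2/3} (log u)^{1/3} ≥ 155 · 1.9` (`155³ ≤ 1944²`, `1.9³ ≤ 7.55 ≤ log 1944`). [folklore] -/
theorem ell_ge_of_ge_1944 {u : ℝ} (hu : 1944 ≤ u) :
    294.5 ≤ u ^ (2 / 3 : ℝ) * Real.log u ^ (1 / 3 : ℝ) := by
  have hu0 : 0 < u := by linarith
  have hv : (151 / 20 : ℝ) ≤ Real.log u :=
    log_1944_ge.trans (Real.log_le_log (by norm_num) hu)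
  have hu23 : (155 : ℝ) ≤ u ^ (2 / 3 : ℝ) := by
    have h1 : (155 : ℝ) ^ (3 : ℕ) ≤ u ^ (2 : ℕ) := by nlinarith
    have h2 : ((155 : ℝ) ^ (3 : ℕ)) ^ (1 / 3 : ℝ) ≤ (u ^ (2 : ℕ)) ^ (1 / 3 : ℝ) :=
      Real.rpow_le_rpow (by positivity) h1 (by norm_num)
    have e1 : ((155 : ℝ) ^ (3 : ℕ)) ^ (1 / 3 : ℝ) = 155 := by
      rw [← Real.rpow_natCast, ← Real.rpow_mul (by norm_num)]; norm_num
    have e2 : (u ^ (2 : ℕ)) ^ (1 / 3 : ℝ) = u ^ (2 / 3 : ℝ) := by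
      rw [← Real.rpow_natCast, ← Real.rpow_mul hu0.le]; norm_num
    rwa [e1, e2] at h2
  have hv13 : (1.9 : ℝ) ≤ Real.log u ^ (1 / 3 : ℝ) := by
    have h1 : (1.9 : ℝ) ^ (3 : ℕ) ≤ Real.log u := by norm_num; linarith
    have h2 : ((1.9 : ℝ) ^ (3 : ℕ)) ^ (1 / 3 : ℝ) ≤ Real.log u ^ (1 / 3 : ℝ) :=
      Real.rpow_le_rpow (by positivity) h1 (by norm_num)
    have e1 : ((1.9 : ℝ) ^ (3 : ℕ)) ^ (1 / 3 : ℝ) = 1.9 := by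
      rw [← Real.rpow_natCast, ← Real.rpow_mul (by norm_num)]; norm_num
    rwa [e1] at h2
  calc (294.5 : ℝ) = 155 * 1.9 := by norm_num
    _ ≤ u ^ (2 / 3 : ℝ) * Real.log u ^ (1 / 3 : ℝ) :=
        mul_le_mul hu23 hv13 (by norm_num) (by positivity)

/-- `log L ≤ L/49 + 3` for `L > 0` (`log x ≤ x − 1` at `x = L/49`, `log 49 ≤ 4`). [folklore] -/
theorem log_le_div_49_add_three {L : ℝ} (hL : 0 < L) : Real.log L ≤ L / 49 + 3 := by
  have h1 : Real.log (L / 49) ≤ L / 49 - 1 := Real.log_le_sub_one_of_pos (by positivity)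
  have h2 : Real.log (L / 49) = Real.log L - Real.log 49 := Real.log_div hL.ne' (by norm_num)
  have h3 := log_49_le
  linarith

/-- **(1.2) is contained in (3.3) above `e^{1944}`**: for `L = log q ≥ log 3` and
`ℓ = (log t)^{2/3}(log log t)^{1/3} ≥ 294.5`,
`10.3 L + 9.791 log L + 61.306 ℓ ≤ 10.5 L + 61.5 ℓ` — the source (p. 5) splits at `q = e^{428}`
(`9.791 log log q < 0.194 ℓ` below, `< 0.13861 log q` above); both slacks together leave a wide margin.
[cite: Khale2024, Proof of Theorem 1.1 (p. 5)] -/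
theorem den33_le_khale_den {L ℓ : ℝ} (hL : 0 < L) (hℓ : 294.5 ≤ ℓ) :
    10.3 * L + 9.791 * Real.log L + 61.306 * ℓ ≤ 10.5 * L + 61.5 * ℓ := by
  have h := log_le_div_49_add_three hL
  nlinarith

/-- **Theorem 1.1 for `t ≥ e^{1944}` from (3.3)** (p. 5–6 of the source: Theorem 3.1 at
`A = 76.2`, `B = 4.45`, `T₀ = e^{1944}` with (3.4)–(3.5) gives (3.3) for `t ≥ e^{1944}`, and
"in either case, (1.2) follows from (3.3)"). [cite: Khale2024, Proof of Theorem 1.1 (pp. 5–6)] -/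
theorem khale_region_of_region33_largeHeight
    (h33 : HasKhaleRegionFrom (Real.exp 1944) 10.3 9.791 61.306)
    {q : ℕ} [NeZero q] (hq : 3 ≤ q) (χ : DirichletCharacter ℂ q) {s : ℂ} (ht : Real.exp 1944 ≤ s.im)
    (hσ : 1 - 1 / (10.5 * Real.log q +
        61.5 * Real.log |s.im| ^ (2 / 3 : ℝ) * Real.log (Real.log |s.im|) ^ (1 / 3 : ℝ)) ≤ s.re) :
    χ.LFunction s ≠ 0 := by
  have ht0 : 0 < s.im := (Real.exp_pos _).trans_le ht
  have habs : |s.im| = s.im := abs_of_pos ht0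
  rw [habs] at hσ
  refine h33 q hq χ s ht (le_trans ?_ hσ)
  have hu : (1944 : ℝ) ≤ Real.log s.im := by
    have := Real.log_le_log (Real.exp_pos _) ht
    rwa [Real.log_exp] at this
  have hℓ := ell_ge_of_ge_1944 hu
  have hq3 : (3 : ℝ) ≤ q := by exact_mod_cast hq
  have hL1 : 1 < Real.log (q : ℝ) :=
    MertensBound.one_lt_log_three.trans_le (Real.log_le_log (by norm_num) hq3)
  have hL0 : 0 < Real.log (q : ℝ) := by linarith
  have hlogL : 0 < Real.log (Real.log (q : ℝ)) := Real.log_pos hL1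
  have hden := den33_le_khale_den hL0 hℓ
  have hpos : 0 < 10.3 * Real.log q + 9.791 * Real.log (Real.log q) +
      61.306 * (Real.log s.im ^ (2 / 3 : ℝ) * Real.log (Real.log s.im) ^ (1 / 3 : ℝ)) := by
    positivity
  have h := one_div_le_one_div_of_le hpos hden
  have e : ∀ c : ℝ, c * Real.log s.im ^ (2 / 3 : ℝ) * Real.log (Real.log s.im) ^ (1 / 3 : ℝ) =
      c * (Real.log s.im ^ (2 / 3 : ℝ) * Real.log (Real.log s.im) ^ (1 / 3 : ℝ)) := fun c ↦ by ring
  rw [e, e]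
  linarith

end KhaleVK

/-! ## Monotonicity of the two predicates -/

/-- A larger constant `R'` is a narrower McCurley region (`log max{q, q|t|, 10} ≥ log 10 > 0`).
[folklore] -/
theorem HasMcCurleyZeroFreeRegion.mono {R R' : ℝ} (h : HasMcCurleyZeroFreeRegion R) (hR : 0 < R)
    (hRR' : R ≤ R') : HasMcCurleyZeroFreeRegion R' := by
  intro q _ χ s ht hσ
  refine h q χ s ht (le_trans ?_ hσ)
  have hM : (10 : ℝ) ≤ max (q : ℝ) (max ((q : ℝ) * |s.im|) 10) :=
    le_trans (le_max_right _ _) (le_max_right _ _)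
  have hlog : 0 < Real.log (max (q : ℝ) (max ((q : ℝ) * |s.im|) 10)) :=
    Real.log_pos (by linarith)
  have hpos : 0 < R * Real.log (max (q : ℝ) (max ((q : ℝ) * |s.im|) 10)) := mul_pos hR hlog
  have hle : R * Real.log (max (q : ℝ) (max ((q : ℝ) * |s.im|) 10)) ≤
      R' * Real.log (max (q : ℝ) (max ((q : ℝ) * |s.im|) 10)) :=
    mul_le_mul_of_nonneg_right hRR' hlog.le
  have := one_div_le_one_div_of_le hpos hle
  linarith

/-- Larger constants `(a', b', c')` give a narrower region of the shape (3.1), from any height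
`T₀ ≥ e` (so that `log t ≥ 1`, `log log t ≥ 0`). [folklore] -/
theorem HasKhaleRegionFrom.mono {T₀ a b c a' b' c' : ℝ} (h : HasKhaleRegionFrom T₀ a b c)
    (hT₀ : Real.exp 1 ≤ T₀) (ha : 0 < a) (hb : 0 ≤ b) (hc : 0 ≤ c) (haa' : a ≤ a') (hbb' : b ≤ b')
    (hcc' : c ≤ c') : HasKhaleRegionFrom T₀ a' b' c' := by
  intro q _ hq χ s ht hσ
  refine h q hq χ s ht (le_trans ?_ hσ)
  have ht0 : 0 < s.im := (Real.exp_pos 1).trans_le (hT₀.trans ht)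
  have hu : 1 ≤ Real.log s.im := by
    have := Real.log_le_log (Real.exp_pos 1) (hT₀.trans ht)
    rwa [Real.log_exp] at this
  have hv : 0 ≤ Real.log (Real.log s.im) := Real.log_nonneg hu
  have hq3 : (3 : ℝ) ≤ q := by exact_mod_cast hq
  have hL1 : 1 < Real.log (q : ℝ) :=
    MertensBound.one_lt_log_three.trans_le (Real.log_le_log (by norm_num) hq3)
  have hL0 : 0 < Real.log (q : ℝ) := by linarith
  have hlogL : 0 < Real.log (Real.log (q : ℝ)) := Real.log_pos hL1
  set ℓ := Real.log s.im ^ (2 / 3 : ℝ) * Real.log (Real.log s.im) ^ (1 / 3 : ℝ) with hℓdef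
  have hℓ : 0 ≤ ℓ := mul_nonneg (Real.rpow_nonneg (by linarith) _) (Real.rpow_nonneg hv _)
  have e : ∀ d : ℝ, d * Real.log s.im ^ (2 / 3 : ℝ) * Real.log (Real.log s.im) ^ (1 / 3 : ℝ) =
      d * ℓ := fun d ↦ by rw [hℓdef]; ring
  rw [e, e]
  have hpos : 0 < a * Real.log q + b * Real.log (Real.log q) + c * ℓ := by positivity
  have hle : a * Real.log q + b * Real.log (Real.log q) + c * ℓ ≤
      a' * Real.log q + b' * Real.log (Real.log q) + c' * ℓ := by
    have h1 := mul_le_mul_of_nonneg_right haa' hL0.le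
    have h2 := mul_le_mul_of_nonneg_right hbb' hlogL.le
    have h3 := mul_le_mul_of_nonneg_right hcc' hℓ
    linarith
  have := one_div_le_one_div_of_le hpos hle
  linarith

/-! ## The reflection principle for every Dirichlet character -/

/-- **Reflection principle** `conj L(conj s, χ) = L(s, χ̄)` for EVERY Dirichlet character `χ` mod `q`
(principal characters included) and every `s ≠ 1`: both sides are holomorphic on the connected open
set `ℂ ∖ {1}` and agree on `Re s > 1` (`DirichletZFR.conj_LFunction_conj_of_one_lt_re`, the Dirichlet
series).  (For `χ ≠ χ₀` this is `DirichletZFR.conj_LFunction_conj`, valid on all of `ℂ`.) [folklore] -/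
theorem conj_LFunction_conj_of_ne_one {q : ℕ} [NeZero q] (χ : DirichletCharacter ℂ q) {s : ℂ}
    (hs : s ≠ 1) : conj (χ.LFunction (conj s)) = χ⁻¹.LFunction s := by
  set U : Set ℂ := {(1 : ℂ)}ᶜ with hUdef
  have hUo : IsOpen U := isOpen_compl_singleton
  have hUc : IsPreconnected U :=
    (isConnected_compl_singleton_of_one_lt_rank (rank_real_complex ▸ Nat.one_lt_ofNat) _).isPreconnected
  have hf : AnalyticOnNhd ℂ χ⁻¹.LFunction U := by
    apply DifferentiableOn.analyticOnNhd _ hUo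
    intro z hz
    exact (DirichletCharacter.differentiableAt_LFunction χ⁻¹ z
      (Or.inl (Set.mem_compl_singleton_iff.1 hz))).differentiableWithinAt
  have hg : AnalyticOnNhd ℂ (conj ∘ χ.LFunction ∘ conj) U := by
    apply DifferentiableOn.analyticOnNhd _ hUo
    intro z hz
    have hz' : conj z ≠ 1 := by
      intro h1
      apply Set.mem_compl_singleton_iff.1 hz
      rw [← Complex.conj_conj z, h1, map_one]
    exact (differentiableAt_conj_conj_iff.mpr
      (DirichletCharacter.differentiableAt_LFunction χ (conj z) (Or.inl hz'))).differentiableWithinAt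
  have h2 : (2 : ℂ) ∈ U := by
    rw [hUdef, Set.mem_compl_singleton_iff]; norm_num
  have hfg : (conj ∘ χ.LFunction ∘ conj) =ᶠ[𝓝 (2 : ℂ)] χ⁻¹.LFunction := by
    have hmem : {s : ℂ | 1 < s.re} ∈ 𝓝 (2 : ℂ) :=
      (isOpen_lt continuous_const Complex.continuous_re).mem_nhds (by simp)
    filter_upwards [hmem] with w hw
    exact DirichletZFR.conj_LFunction_conj_of_one_lt_re χ hw
  have := hg.eqOn_of_preconnected_of_eventuallyEq hf hUc h2 hfg
    (Set.mem_compl_singleton_iff.2 hs)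
  simpa using this

/-- **It suffices to treat the upper half-plane** (p. 3 of the source: "since `L(s̄, χ) = conj L(s, χ̄)`,
the zeros of `L(s, χ)L(s, χ̄)` come in conjugate pairs … we will impose the restriction `Im(s) ≥ 0`
without loss of generality"): Khale's region (1.2) is symmetric in `t`, and a zero `s` with
`Im s ≤ −10` of `L(·, χ)` is a zero `s̄` with `Im s̄ ≥ 10` of `L(·, χ̄)` (`conj_LFunction_conj_of_ne_one`).
[cite: Khale2024, §2.1 (p. 3)] -/
theorem Khale2024_zeroFreeRegion_of_upperHalfPlane
    (h : ∀ (q : ℕ) [NeZero q], 3 ≤ q → ∀ (χ : DirichletCharacter ℂ q) (s : ℂ), 10 ≤ s.im →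
      1 - 1 / (10.5 * Real.log q +
        61.5 * Real.log |s.im| ^ (2 / 3 : ℝ) * Real.log (Real.log |s.im|) ^ (1 / 3 : ℝ)) ≤ s.re →
      χ.LFunction s ≠ 0) :
    Khale2024_zeroFreeRegion := by
  intro q _ hq χ s ht hσ
  rcases le_or_gt 0 s.im with h0 | h0
  · exact h q hq χ s (by rwa [abs_of_nonneg h0] at ht) hσ
  · intro hzero
    have ht' : 10 ≤ (conj s).im := by
      rw [Complex.conj_im]
      rwa [abs_of_neg h0] at ht
    have hs1 : conj s ≠ 1 := by
      intro h1
      have := congrArg Complex.im h1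
      rw [Complex.conj_im, Complex.one_im] at this
      linarith
    have key := conj_LFunction_conj_of_ne_one χ hs1
    rw [Complex.conj_conj, hzero, map_zero] at key
    refine h q hq χ⁻¹ (conj s) ht' ?_ key.symm
    rw [Complex.conj_re, Complex.conj_im, abs_neg]
    exact hσ

/-! ## Theorem 1.1 from the two inputs of its printed proof -/

/-- **Khale's Theorem 1.1 in the upper half-plane from (2.3) and (3.3)**: McCurley's region for
`10 ≤ t ≤ e^{1944}` and the region (3.3) for `t ≥ e^{1944}`.
[cite: Khale2024, Proof of Theorem 1.1 (pp. 5–6)] -/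
theorem khale_region_upperHalfPlane_of_mccurley_of_region33
    (hR : HasMcCurleyZeroFreeRegion 9.645908801)
    (h33 : HasKhaleRegionFrom (Real.exp 1944) 10.3 9.791 61.306)
    {q : ℕ} [NeZero q] (hq : 3 ≤ q) (χ : DirichletCharacter ℂ q) {s : ℂ} (ht : 10 ≤ s.im)
    (hσ : 1 - 1 / (10.5 * Real.log q +
        61.5 * Real.log |s.im| ^ (2 / 3 : ℝ) * Real.log (Real.log |s.im|) ^ (1 / 3 : ℝ)) ≤ s.re) :
    χ.LFunction s ≠ 0 := by
  rcases le_or_gt s.im (Real.exp 1944) with hle | hlt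
  · exact KhaleVK.khale_region_of_mccurley_smallHeight hR hq χ ht hle hσ
  · exact KhaleVK.khale_region_of_region33_largeHeight h33 hq χ hlt.le hσ

/-- **"Proof of Theorem 1.1, assuming Theorem 3.1"** (pp. 5–6 of the source), as a reduction of the
named fact `Khale2024_zeroFreeRegion` to the two analytic inputs of its printed proof: McCurley's
explicit classical region (2.3) with `R = 9.645908801` (off the real axis), and the region (3.3) above
`e^{1944}` — the output of Theorem 3.1 of the source at `A = 76.2`, `B = 4.45` (Ford's Hurwitz bound
(2.4)), `T₀ = e^{1944}`, after the numerical bounds (3.4)–(3.5).  The reflection `t ↦ −t`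
(`Khale2024_zeroFreeRegion_of_upperHalfPlane`) supplies `t ≤ −10`.
[cite: Khale2024, Theorem 1.1 and its proof (pp. 5–6)] [cite: McCurley1984ErrorTermAP, Theorem 1.1] -/
theorem Khale2024_zeroFreeRegion_of_mccurley_of_region33
    (hR : HasMcCurleyZeroFreeRegion 9.645908801)
    (h33 : HasKhaleRegionFrom (Real.exp 1944) 10.3 9.791 61.306) : Khale2024_zeroFreeRegion :=
  Khale2024_zeroFreeRegion_of_upperHalfPlane fun _ _ hq χ _ ht hσ ↦
    khale_region_upperHalfPlane_of_mccurley_of_region33 hR h33 hq χ ht hσ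

end Literature.NumberTheory.LFunctions
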